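import Summits.BirchSwinnertonDyer.Rank1Residual.X11b.AnticyclotomicLevelStructure
import Summits.BirchSwinnertonDyer.Rank1Residual.X11b.AnticyclotomicControlAtoms
import Literature.NumberTheory.GaloisRepresentations.AbsGaloisGroupCompact
import HarnessLib

/-!
# X11b, route R1 — the atom (P9) `LocSurjAt` (JSW17 Prop. 3.3.2) REDUCED to a finite-level
# lifting statement in the Poitou–Tate vocabulary (`LevelLiftingAt`)

HONEST FRAMING (cell `b2b-bsdres`, run/shared/lean/b2b/bsd-rank1-residual/, verbatim in every
file): the goal of the cell is to DELETE the COMBINATION-SHAPED residual classes of the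
Birch–Swinnerton-Dyer formula for ALL analytic-rank `≤ 1` elliptic curves over `ℚ` — "full BSD
formula for every rank `≤ 1` curve in class `C`" assembled STRICTLY from published theorems — so
that the rank-`≤ 1` remainder becomes exactly the CONSTRUCTION-SHAPED classes, which are TYPED
(missing-input `Prop`s), NOT attempted. This is not "finishing BSD". Sub-cell
`b2b-bsdres-multr1-p1` (X11b, route R1 = Castella 2018 Thm. A re-proved along the author's
erratum); a RESEARCH ROUTE; no claim beyond the stated class; X11b stays CONSTRUCTION-SHAPED;
nothing here changes a label; no named fact is minted (definitions with bodies — a corestricted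
homomorphism, an inflation map, and ONE `Prop`-valued predicate `LevelLiftingAt`, a typed SHAPE
with nothing asserted — and theorems; no `sorry`).

## What is here

Atom (P9) of Cas18 Thm. 2.3 on route R1's objects (`AnticyclotomicControlAtoms.LocSurjAt`,
JSW17 Prop. 3.3.2 / §3.3.4: `loc_Σ : Sel_𝔭^Σ(K, E[p^∞]) → ∏_{w∈Σ} H¹(K_w, E[p^∞])` is onto, where
route R1's `H¹(K_w, ·)` is `H¹(⊤ ⊓ D_w, ·)` at the decomposition group) is DERIVED from the
finite-level statement `LevelLiftingAt` — "every family `(τ_w)_{w∈Σ}` of local classes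
`τ_w ∈ H¹(K_w, E[p^∞])` (completions) killed by `p^{K₀}` is the localisation of the image of a
class of `H¹_{𝓛^{(N)}}(K, E[p^N])` for some level `N`" — which is the shape in which Poitou–Tate
duality for Selmer structures (`poitouTate_selmerStructure_duality`, element form (i) of
`SelmerComplement`) delivers global classes.  Ingredients, all kernel theorems:

* `LocBridge.decompCorestrict v : Γ_{K_v} →ₜ* ⊤ ⊓ D_v` (onto) and
  `LocBridge.inflToCompletion hM v : H¹(⊤ ⊓ D_v, M) →+ H¹(K_v, M)` — inflation to the completion;
  **injective** (`inflToCompletion_injective`, inflation along a surjection; `LocalTrivialityBridge`)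
  and **compatible**: `inflToCompletion (res_{D_v} (topEquivH1 c)) = loc_v c`
  (`inflToCompletion_resOfLe_topEquivH1`).
* `Levels.exists_pow_nsmul_eq_zero_of_primary` — every class of `H¹(F, B)` for a `p`-primary
  discrete module `B` over any field `F` is killed by a power of `p` (compactness of `Γ_F`); so are
  the local classes `H¹(K_v, E[p^∞])`.
* `AcSelmer.LevelLiftingAt W p 𝔭 Σ` (typed shape) and
  **`AcSelmer.locSurjAt_of_levelLifting : LevelLiftingAt W p 𝔭 hS → LocSurjAt W p 𝔭 hS`**.

So after this file the Poitou–Tate atom (P9) is, in the kernel, a statement about FINITE modules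
`E[p^N]` and the tree's Selmer-structure vocabulary; what remains for it (successor work, REPORT
§24): `LevelLiftingAt` ⟸ `SelmerComplement` (i) at level `p^N` for `𝓛^{(N),∅} ≤ 𝓛^{(N),Σ}` +
`IsUnramifiedOutside` of the propagated conditions at good `v ∤ p` + the dual-side vanishing, which
by the level-shifting/Tate-module argument follows from the FINITENESS of Castella's group for the
conjugate prime `Sel_𝔭̄(K, E[p^∞])` (JSW17 proof of Prop. 3.3.2: "`H¹_{(F_ac^S)_v̄}(K, T) = 0`").

References: [JetchevSkinnerWan2017] Prop. 3.3.2, §3.3.4 (arXiv:1512.06894 pp. 11, 13);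
[Castella2018] Thm. 2.3; [Howard2004HeegnerKolyvagin] Def. 2.1.1, Thm. 2.1.11;
[GreenbergLNM1716] §2–3.
-/

noncomputable section

open scoped Classical

open CategoryTheory NumberField IsDedekindDomain Field
open Literature.NumberTheory.EllipticCurves Literature.NumberTheory.EllipticCurves.GreenbergSelmer
open Literature.NumberTheory.GaloisRepresentations
open Literature.NumberTheory.GaloisRepresentations.DiscreteGaloisModule (SelmerStructure)
open scoped ContRepresentation

universe u

/-! ## §1. Inflation from the decomposition group to the completion: injective and compatible -/

namespace Summit.BirchSwinnertonDyer.Rank1Residual.X11b.LocBridge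

section Inflation

variable {K : Type u} [Field K] [NumberField K]
variable {M : Type u} [AddCommGroup M] [DistribMulAction (absoluteGaloisGroup K) M]
  [TopologicalSpace M] [DiscreteTopology M]
  (hM : ∀ m : M, IsOpen {σ : absoluteGaloisGroup K | σ • m = m})

/-- The corestriction `Γ_{K_v} → ⊤ ⊓ D_v` of `absGaloisRestrict K K_v` (`D_v = decomp v` IS its
range; `⊤ ⊓ D_v` is the group at which route R1's local classes live). [cite: GreenbergLNM1716, §2] -/
def decompCorestrict (v : HeightOneSpectrum (𝓞 K)) :
    absoluteGaloisGroup (v.adicCompletion K) →ₜ*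
      ((⊤ : Subgroup (absoluteGaloisGroup K)) ⊓ decomp v : Subgroup (absoluteGaloisGroup K)) where
  toFun σ := ⟨absGaloisRestrict K (v.adicCompletion K) σ,
    Subgroup.mem_inf.mpr ⟨Subgroup.mem_top _, (mem_decomp_iff v _).mpr ⟨σ, rfl⟩⟩⟩
  map_one' := Subtype.ext (map_one _)
  map_mul' σ τ := Subtype.ext (map_mul _ σ τ)
  continuous_toFun := (absGaloisRestrict K (v.adicCompletion K)).continuous.subtype_mk _

/-- Unfolding `decompCorestrict`. [folklore] -/
@[simp]
theorem coe_decompCorestrict_apply (v : HeightOneSpectrum (𝓞 K))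
    (σ : absoluteGaloisGroup (v.adicCompletion K)) :
    ((decompCorestrict v σ : ((⊤ : Subgroup (absoluteGaloisGroup K)) ⊓ decomp v :
      Subgroup (absoluteGaloisGroup K))) : absoluteGaloisGroup K) =
      absGaloisRestrict K (v.adicCompletion K) σ :=
  rfl

/-- `decompCorestrict v` is onto `⊤ ⊓ D_v`. [cite: GreenbergLNM1716, §2] -/
theorem decompCorestrict_surjective (v : HeightOneSpectrum (𝓞 K)) :
    Function.Surjective (decompCorestrict v) := by
  rintro ⟨d, hd⟩
  obtain ⟨σ, hσ⟩ := (mem_decomp_iff v d).mp (Subgroup.mem_inf.mp hd).2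
  exact ⟨σ, Subtype.ext hσ⟩

/-- The `TopRep` morphism "identity on `M`" from the restriction along `decompCorestrict v` of the
subgroup representation to the restricted module at `K_v`. [folklore] -/
def inflHom (v : HeightOneSpectrum (𝓞 K)) :
    TopRep.res (decompCorestrict v : absoluteGaloisGroup (v.adicCompletion K) →*
        ((⊤ : Subgroup (absoluteGaloisGroup K)) ⊓ decomp v : Subgroup (absoluteGaloisGroup K)))
      (discreteTopRep ((⊤ : Subgroup (absoluteGaloisGroup K)) ⊓ decomp v :
        Subgroup (absoluteGaloisGroup K)) M) ⟶
      DiscreteGaloisModule.toTopRep (GaloisRep.restrictField (v.adicCompletion K) (ofSMul M hM)) :=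
  TopRep.ofHom ⟨ContinuousLinearMap.id ℤ M, fun _ ↦ rfl⟩

/-- **Inflation to the completion** `H¹(⊤ ⊓ D_v, M) → H¹(K_v, M) = H¹(Γ_{K_v}, M)`: pull-back along
`decompCorestrict v` (identity on the coefficients `M`, on which `Γ_{K_v}` acts through
`absGaloisRestrict`). [cite: GreenbergLNM1716, §2] -/
def inflToCompletion (v : HeightOneSpectrum (𝓞 K)) :
    subgroupH1 ((⊤ : Subgroup (absoluteGaloisGroup K)) ⊓ decomp v) M →+
      galoisCohomology ((ofSMul M hM).toLocal (Sum.inr v)) 1 :=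
  (ContinuousCohomology.map (decompCorestrict v) (inflHom hM v) 1).hom.toLinearMap.toAddMonoidHom

/-- `inflToCompletion` on a class: `[φ] ↦ [φ ∘ decompCorestrict v]`. [folklore] -/
theorem inflToCompletion_oneCocycleClass (v : HeightOneSpectrum (𝓞 K))
    (φ : contOneCocycles (discreteTopRep
      ((⊤ : Subgroup (absoluteGaloisGroup K)) ⊓ decomp v : Subgroup (absoluteGaloisGroup K)) M)) :
    inflToCompletion hM v (oneCocycleClass _ φ) =
      oneCocycleClass _ (contOneCocycles.pullback (decompCorestrict v) (inflHom hM v) φ) :=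
  map_oneCocycleClass _ _ _ φ

/-- **Inflation to the completion is injective** (inflation along the surjection
`Γ_{K_v} ↠ ⊤ ⊓ D_v`: a cocycle principal on the range is principal;
`LocBridge.map_oneCocycleClass_eq_zero_iff`). [cite: GreenbergLNM1716, §2] -/
theorem inflToCompletion_injective (v : HeightOneSpectrum (𝓞 K)) :
    Function.Injective (inflToCompletion hM v) := by
  rw [injective_iff_map_eq_zero]
  intro t ht
  obtain ⟨φ, rfl⟩ := oneCocycleClass_surjective _ t
  obtain ⟨x, hx⟩ := (map_oneCocycleClass_eq_zero_iff _ _ (decompCorestrict v) (inflHom hM v)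
    Function.bijective_id φ).mp ht
  refine (oneCocycleClass_eq_zero_iff _ _).mpr ⟨x, fun d ↦ ?_⟩
  obtain ⟨σ, rfl⟩ := decompCorestrict_surjective v d
  exact hx σ

/-- `resH1Hom` on a class (`map_oneCocycleClass`). [folklore] -/
theorem resH1Hom_oneCocycleClass' {G : Type u} [Group G] [TopologicalSpace G] [IsTopologicalGroup G]
    {L : Type u} [Group L] [TopologicalSpace L] [IsTopologicalGroup L]
    {N : Type u} [AddCommGroup N] [DistribMulAction G N] [TopologicalSpace N] [DiscreteTopology N]
    {N' : Type u} [AddCommGroup N'] [DistribMulAction L N'] [TopologicalSpace N']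
    [DiscreteTopology N'] (θ : L →ₜ* G) (ψ : N →+ N')
    (h : ∀ (l : L) (n : N), ψ (θ l • n) = l • ψ n) (φ : contOneCocycles (discreteTopRep G N)) :
    resH1Hom θ ψ h (oneCocycleClass _ φ) =
      oneCocycleClass _ (contOneCocycles.pullback θ (resHomOfEquivariant θ ψ h) φ) :=
  map_oneCocycleClass _ _ _ φ

/-- **Compatibility: inflating route R1's local component gives the localisation** —
`inflToCompletion (res_{⊤⊓D_v} (topEquivH1 c)) = loc_v c` for every `c ∈ H¹(K, M)` (all three maps
are pull-backs of the same cocycle along `Γ_{K_v} → Γ_K`). [cite: GreenbergLNM1716, §2] -/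
theorem inflToCompletion_resOfLe_topEquivH1 (v : HeightOneSpectrum (𝓞 K))
    (c : galoisCohomology (ofSMul M hM) 1) :
    inflToCompletion hM v
        (resOfLe M (inf_le_left : (⊤ : Subgroup (absoluteGaloisGroup K)) ⊓ decomp v ≤ ⊤)
          (topEquivH1 hM c)) =
      galoisCohomology.localization (ofSMul M hM) (Sum.inr v) 1 c := by
  obtain ⟨φ, rfl⟩ := oneCocycleClass_surjective (ofSMul M hM).toTopRep c
  rw [topEquivH1_apply, toDiscreteH1_apply]
  change inflToCompletion hM v (resOfLe M _ (resH1Hom _ _ _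
    (oneCocycleClass (discreteTopRep (absoluteGaloisGroup K) M) φ))) =
    galoisCohomology.res (ofSMul M hM) (v.adicCompletion K) 1 (oneCocycleClass _ φ)
  rw [resH1Hom_oneCocycleClass', resOfLe, resH1Hom_oneCocycleClass',
    inflToCompletion_oneCocycleClass, galoisCohomology.res_one_oneCocycleClass]
  exact congrArg (oneCocycleClass _) (Subtype.ext (ContinuousMap.ext fun σ ↦ rfl))

end Inflation

end Summit.BirchSwinnertonDyer.Rank1Residual.X11b.LocBridge

/-! ## §2. Classes with `p`-primary coefficients are killed by a power of `p` -/

namespace Summit.BirchSwinnertonDyer.Rank1Residual.X11b.Levels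

section Primary

variable {F : Type u} [Field F] {B : Type u} [AddCommGroup B] [TopologicalSpace B]
  [DiscreteTopology B] (ρB : DiscreteGaloisModule F B)

/-- **`H¹(F, B)` is `p`-primary for a `p`-primary discrete Galois module `B`** (over ANY field `F`,
e.g. a completion `K_v`): a continuous cocycle on the compact `Γ_F`
(`absoluteGaloisGroup_compactSpace`) with values in the discrete `B` has finite image, so one
power of `p` kills it. Greenberg LNM 1716 §2. [folklore] -/
theorem exists_pow_nsmul_eq_zero_of_primary {p : ℕ} (hB : ∀ b : B, ∃ k : ℕ, p ^ k • b = 0)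
    (x : galoisCohomology ρB 1) : ∃ N : ℕ, p ^ N • x = 0 := by
  haveI : CompactSpace (absoluteGaloisGroup F) := absoluteGaloisGroup_compactSpace F
  obtain ⟨f, rfl⟩ := oneCocycleClass_surjective _ x
  obtain ⟨N, hN⟩ := exists_pow_smul_apply_eq_zero f.1 fun g ↦ hB (f.1 g)
  refine ⟨N, ?_⟩
  have hf : ((p ^ N : ℕ) : ℤ) • f = 0 := Subtype.ext (ContinuousMap.ext fun σ ↦ by
    change ((p ^ N : ℕ) : ℤ) • f.1 σ = 0
    rw [natCast_zsmul, hN])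
  have h := oneCocycleClass_smul ρB.toTopRep ((p ^ N : ℕ) : ℤ) f
  rw [hf, oneCocycleClass_zero] at h
  conv at h => rhs; rw [Nat.cast_smul_eq_nsmul]
  exact h.symm

/-- The local classes `H¹(K_v, E[p^∞])` (restricted module at a `K`-field `E`) are killed by powers
of `p`. [folklore] -/
theorem exists_pow_nsmul_eq_zero_restrictField_primary {K : Type u} [Field K]
    (W : WeierstrassCurve K) (p : ℕ) (E : Type u) [Field E] [Algebra K E]
    (x : galoisCohomology (GaloisRep.restrictField E (LocBridge.primaryGaloisModule W p)) 1) :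
    ∃ N : ℕ, p ^ N • x = 0 :=
  exists_pow_nsmul_eq_zero_of_primary _
    (fun Q ↦ AddCommGroup.mem_primaryComponent.mp Q.2 |>.imp fun k hk ↦
      Subtype.ext (by rw [AddSubmonoidClass.coe_nsmul, hk, ZeroMemClass.coe_zero])) x

end Primary

end Summit.BirchSwinnertonDyer.Rank1Residual.X11b.Levels

/-! ## §3. (P9) from the finite-level lifting statement -/

namespace Summit.BirchSwinnertonDyer.Rank1Residual.X11b.AcSelmer

open Summit.BirchSwinnertonDyer.Rank1Residual.X11b.LocBridge
open Summit.BirchSwinnertonDyer.Rank1Residual.X11b.Levels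

variable {K : Type} [Field K] [NumberField K] (W : WeierstrassCurve K) (p : ℕ)
  (𝔭 : HeightOneSpectrum (𝓞 K)) {S : Set (HeightOneSpectrum (𝓞 K))} (hS : S.Finite)

/-- **`LevelLiftingAt W p 𝔭 Σ` — the finite-level lifting statement (typed SHAPE; nothing
asserted).** For every exponent `K₀` and every family `(τ_w)_{w ∈ Σ}` of local classes
`τ_w ∈ H¹(K_w, E[p^∞])` (completions; restricted module) with `p^{K₀} τ_w = 0`, there are a level `N`
and a class `x ∈ H¹_{𝓛^{(N)}}(K, E[p^N])` of the PROPAGATED Castella structure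
(`acLevelStructure W p N 𝔭 Σ`) whose image in `H¹(K, E[p^∞])` localises to `τ_w` at every `w ∈ Σ`.
This is the form in which Poitou–Tate duality for Selmer structures (Howard Thm. 2.1.11, element
form (i), tree fact `poitouTate_selmerStructure_duality`) produces the global classes of JSW17
Prop. 3.3.2 (restrict-eq2); it implies (P9) (`locSurjAt_of_levelLifting`).  NOT a named fact; to be
DISCHARGED from the PT fact, the unramifiedness of the propagated conditions at good `v ∤ p`, and
the finiteness of `Sel_𝔭̄(K, E[p^∞])`.
[cite: JetchevSkinnerWan2017, Prop. 3.3.2 (arXiv:1512.06894 p. 11) (shape only; nothing asserted)]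
[cite: Howard2004HeegnerKolyvagin, Thm. 2.1.11 (arXiv:1202.6340 p. 6) (shape only)] -/
def LevelLiftingAt (S : Set (HeightOneSpectrum (𝓞 K))) : Prop :=
  ∀ (K₀ : ℕ) (τ : ∀ v : S,
      galoisCohomology ((primaryGaloisModule W p).toLocal (Sum.inr (v : HeightOneSpectrum (𝓞 K)))) 1),
    (∀ v, p ^ K₀ • τ v = 0) →
      ∃ (N : ℕ) (x : galoisCohomology (W.torsionGaloisModule ((p ^ N : ℕ) : ℤ)) 1),
        x ∈ (acLevelStructure W p N 𝔭 S).selmerGroup ∧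
          ∀ v : S, galoisCohomology.localization (primaryGaloisModule W p)
              (Sum.inr (v : HeightOneSpectrum (𝓞 K))) 1
              (galoisCohomology.map (primaryInclusion W p N) 1 x) = τ v

variable {W p 𝔭}

/-- A finite family of local classes of `E[p^∞]` has a common killing exponent. [folklore] -/
theorem exists_pow_nsmul_family_eq_zero (hS : S.Finite)
    (τ : ∀ v : S,
      galoisCohomology ((primaryGaloisModule W p).toLocal (Sum.inr (v : HeightOneSpectrum (𝓞 K)))) 1) :
    ∃ K₀ : ℕ, ∀ v, p ^ K₀ • τ v = 0 := by
  haveI : Fintype S := hS.fintype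
  choose k hk using fun v : S ↦
    exists_pow_nsmul_eq_zero_restrictField_primary W p
      (Place.Completion (Sum.inr (v : HeightOneSpectrum (𝓞 K)) : Place K)) (τ v)
  refine ⟨Finset.univ.sum k, fun v ↦ ?_⟩
  have hle : k v ≤ Finset.univ.sum k :=
    Finset.single_le_sum (fun _ _ ↦ Nat.zero_le _) (Finset.mem_univ v)
  rw [← pow_mul_pow_sub p hle, mul_comm, mul_smul, show p ^ k v • τ v = 0 from hk v, smul_zero]

/-- **(P9) from the finite-level lifting statement.**  `LevelLiftingAt W p 𝔭 Σ ⟹ LocSurjAt W p 𝔭 Σ`: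
given a family `t_w ∈ H¹(⊤ ⊓ D_w, E[p^∞])` (`w ∈ Σ`), inflate it to the completions
(`inflToCompletion`), take a common killing exponent `p^{K₀}`, lift at some level `N` to
`x ∈ H¹_{𝓛^{(N)}}(K, E[p^N])`, push to `Sel_𝔭^Σ(K, E[p^∞])` (`topEquivH1 ∘ H¹(ι_N)`,
`mem_selmerGroup_acLevelStructure_iff_selmerAcBase`); its local components inflate to the `τ_w`
(`inflToCompletion_resOfLe_topEquivH1`), hence equal the `t_w` by injectivity of inflation.
[cite: JetchevSkinnerWan2017, Prop. 3.3.2 and §3.3.4 (arXiv:1512.06894 pp. 11, 13)]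
[cite: Castella2018, Thm. 2.3 (arXiv:1704.06608 p. 5)] -/
theorem locSurjAt_of_levelLifting [Fact p.Prime] (hS : S.Finite) (h : LevelLiftingAt W p 𝔭 S) :
    LocSurjAt W p 𝔭 hS := by
  intro t
  let τ : ∀ v : S, galoisCohomology ((primaryGaloisModule W p).toLocal
      (Sum.inr (v : HeightOneSpectrum (𝓞 K)))) 1 :=
    fun v ↦ inflToCompletion (isOpen_stabilizer_geomPrimaryTorsion W p) (v : HeightOneSpectrum (𝓞 K))
      (t ⟨v, hS.mem_toFinset.mpr v.2⟩)
  obtain ⟨K₀, hK₀⟩ := exists_pow_nsmul_family_eq_zero hS τ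
  obtain ⟨N, x, hx, hloc⟩ := h K₀ τ hK₀
  refine ⟨⟨topEquivH1 (isOpen_stabilizer_geomPrimaryTorsion W p)
      (galoisCohomology.map (primaryInclusion W p N) 1 x),
    (mem_selmerGroup_acLevelStructure_iff_selmerAcBase W p N 𝔭 S x).mp hx⟩, ?_⟩
  funext v
  apply inflToCompletion_injective (isOpen_stabilizer_geomPrimaryTorsion W p)
    (v : HeightOneSpectrum (𝓞 K))
  rw [locSel_apply]
  change inflToCompletion _ _ (resOfLe (W.geomPrimaryTorsion p) _ (topEquivH1 _ _)) = _
  rw [inflToCompletion_resOfLe_topEquivH1]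
  exact hloc ⟨v, hS.mem_toFinset.mp v.2⟩

end Summit.BirchSwinnertonDyer.Rank1Residual.X11b.AcSelmer

end
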